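import Literature.Probability.Percolation.SlabCircuitTheorem310Uniform
import Literature.Probability.Percolation.SlabBoxCrossingPropertyCorollaries
import HarnessLib

/-!
# Newman–Tassion–Wu 2017, Corollary 3.2 (i) from the box-crossing property: open circuits in annuli
# with positive probability

Topic: `Literature/Probability/Percolation`. NTW (arXiv:1512.09107), Corollary 3.2 (i): for critical
Bernoulli percolation on the slab `S_k` "there exists `c > 0` such that for every `n ≥ 1`,
`P_p[there exists an open circuit in Ā_{n,2n} surrounding B̄_n] ≥ c`". In the tree the step
"hard crossings ⟹ surrounding open circuits" is NTW's Theorem 3.10 in the form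
`NTW17.h310_holds_uniform` (p1 GEN 30): for `p ∈ [ε, 1-ε]` and `n ≥ m₀ ≥ 52`, `f_p(2n, n-1) ≥ c`
gives an open circuit surrounding `z` in the annulus `Ā_{λn, 2λn}(z)` with probability `≥ c′`, for a
scale factor `λ = λ(k, ε, c) ≥ 1`. This file combines it with the box-crossing property
(`NTW17.BoxCrossingProperty`, lower half at aspect `1/4` + height monotonicity):

* `NTW17.BoxCrossingProperty.circuitAround` — for `k ≥ 1`, `0 < p < 1` with `BoxCrossingProperty k p`:
  `∃ λ ≥ 1, ∃ c′ > 0, ∀ n ≥ 52, ∀ z, P_p[circuitAround k z (λn) (2λn)] ≥ c′`;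
* `NewmanTassionWu2017.cor32_i` — the same at `p = p_c(S_k)` for every `k ≥ 1`, CONDITIONAL on the
  named fact `NewmanTassionWu2017_thm31` and on `0 < p_c(S_k) < 1` (supplied Summits-side).

The annulus is NTW's up to the fixed scale factor `λ` of Theorem 3.10 (their Corollary 3.2 (i) has
`λ = 1`, obtained from (3.62) by gluing four hard crossings directly; here we reuse Theorem 3.10).

## Sources

* C. M. Newman, V. Tassion, W. Wu, *Critical percolation and the minimal spanning tree in slabs*,
  Comm. Pure Appl. Math. 70 (2017), arXiv:1512.09107: Corollary 3.2 (i), Theorem 3.10, §3.8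
  [NewmanTassionWu2017].
-/

noncomputable section

namespace Literature.Probability.Percolation

open MeasureTheory LatticeModels SimpleGraph

namespace NTW17

variable {k : ℕ}

/-- **Cor. 3.2 (i) from the box-crossing property** (any `0 < p < 1`, `k ≥ 1`): there are `λ ≥ 1` and
`c′ > 0` with `P_p[an open circuit of Ā_{λn,2λn}(z) surrounds z̄] ≥ c′` for every `n ≥ 52` and every
centre `z` — the lower bound `f_p(2n, ⌊n/2⌋) ≥ c` (aspect `1/4` at width `2n`), height monotonicity
to `f_p(2n, n-1) ≥ c`, and Theorem 3.10 (`h310_holds_uniform`).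
[cite: NewmanTassionWu2017, Corollary 3.2 (i) and Theorem 3.10] -/
theorem BoxCrossingProperty.circuitAround (hk : 1 ≤ k) {p : unitInterval} (h : BoxCrossingProperty k p)
    (hp0 : 0 < (p : ℝ)) (hp1 : (p : ℝ) < 1) :
    ∃ lam : ℕ, 1 ≤ lam ∧ ∃ c' : ℝ, 0 < c' ∧ ∀ n : ℕ, 52 ≤ n → ∀ z : ℤ × ℤ,
      c' ≤ (bondPercolation (slabGraph 3 k) p).real (circuitAround k z (lam * n) (2 * (lam * n))) := by
  -- `p ∈ [ε, 1-ε]`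
  set ε : ℝ := min (p : ℝ) (1 - p) with hε
  have hε0 : 0 < ε := lt_min hp0 (by linarith)
  have hεp : ε ≤ (p : ℝ) := min_le_left _ _
  have hpε : (p : ℝ) ≤ 1 - ε := by have := min_le_right (p : ℝ) (1 - p); linarith
  -- the hard crossings: `f(2n, n-1) ≥ c` for `n ≥ 2`
  obtain ⟨c, hc, hlow⟩ := h.lower (ρ := 1 / 4) (by norm_num)
  have hhard : ∀ n : ℕ, 2 ≤ n → c ≤ crossingProb k p (2 * n) (n - 1) := by
    intro n hn
    have h1 : (1 : ℝ) ≤ 1 / 4 * ((2 * n : ℕ) : ℝ) := by push_cast; linarith [show (2 : ℝ) ≤ n by exact_mod_cast hn]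
    have h2 := hlow (2 * n) h1
    have hfl : ⌊(1 / 4 : ℝ) * ((2 * n : ℕ) : ℝ)⌋₊ ≤ n - 1 := by
      apply Nat.floor_le_of_le
      rw [Nat.cast_sub (by omega : 1 ≤ n)]
      push_cast
      linarith [show (2 : ℝ) ≤ n by exact_mod_cast hn]
    exact h2.trans (crossingProb_mono p le_rfl hfl)
  -- Theorem 3.10
  obtain ⟨lam, hlam, c', hc', H⟩ := h310_holds_uniform hk (m₀ := 52) le_rfl ε hε0 c hc
  exact ⟨lam, hlam, c', hc', fun n hn z => H p hεp hpε n hn (hhard n (le_trans (by norm_num) hn)) z⟩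

end NTW17

/-- **NTW 2017, Corollary 3.2 (i) at `p_c(S_k)`** (open circuits in the annuli `Ā_{λn,2λn}(z)` with
probability `≥ c′`, every `n ≥ 52`, every centre), CONDITIONAL on the named fact
`NewmanTassionWu2017_thm31` and on `0 < p_c(S_k) < 1`. [cite: NewmanTassionWu2017, Corollary 3.2 (i)] -/
theorem NewmanTassionWu2017.cor32_i (h : NewmanTassionWu2017_thm31) {k : ℕ} (hk : 1 ≤ k)
    (hp0 : 0 < ((criticalProbIOf (slabGraph 3 k) (slabOrigin 3 k) : unitInterval) : ℝ))
    (hp1 : ((criticalProbIOf (slabGraph 3 k) (slabOrigin 3 k) : unitInterval) : ℝ) < 1) :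
    ∃ lam : ℕ, 1 ≤ lam ∧ ∃ c' : ℝ, 0 < c' ∧ ∀ n : ℕ, 52 ≤ n → ∀ z : ℤ × ℤ,
      c' ≤ (bondPercolation (slabGraph 3 k) (criticalProbIOf (slabGraph 3 k) (slabOrigin 3 k))).real
        (NTW17.circuitAround k z (lam * n) (2 * (lam * n))) :=
  (h k hk).circuitAround hk hp0 hp1

end Literature.Probability.Percolation
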